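import Literature.NumberTheory.Rogawski1990.ArchOrbFamGExtFaceJetBounds     -- ★ p851037 (this seat) (B2) ED. 1: §1 generic jet lemmas, §2 semiregular neighbourhood, §3∕§4 heads
import Literature.NumberTheory.Rogawski1990.ArchHcJumpWordLetters           -- ★ p851021 (F0P3a-p08 (g23)) FILE 2a: `exists_clm_wallChart`, `wallChart_add_smul_hcNrm`, `contDiffOn_cofactorReader`; brings ★ FILE 1∕1b readers
import Literature.Analysis.Calculus.IteratedFDerivParamWordsLocal           -- ★ p850991 (F0P3a-p08 (g23)) FILE 1b: `iteratedFDeriv_readers_eq_iteratedDeriv_foldr_local`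
import Literature.Analysis.Calculus.IteratedFDerivNestedPartials            -- ★ p850958 (LH7-p02 (g4)) (B2b): `exists_forall_norm_iteratedFDeriv_le_of_apply_basis`
import HarnessLib

/-!
# (I₁) AT THE FACES, ED. 2: the face `hwall` for `orbFamGExt` from a WALL-DESCENT READER FAMILY — uniform rank-one bounds + nested partials + the wall chart
# (Harish-Chandra ∕ Varadarajan 1977 I §1.12; Bouaziz 1994 §3.1 (I₁)–(I₂), §3.2; Shelstad 1979 §4; Hörmander ALPDO I §1.1)

Topic `NumberTheory/Rogawski1990`; namespaces `Literature.Analysis.Calculus` (§0, §C: generic) and `Literature.NumberTheory.Rogawski1990` (§D).  THEOREMS ONLY (no `def`, no instance, no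
notation, no axiom, no named fact, no `sorry`).  Cell `pub/hodgecm-mathlib`, crux H413 (`stmt-HodgeConjecture-24833`), F0∕P3c line LH3 (closer stub `stub_N9`, DIRECT ROAD), LETTER L1
clause (I₁), brick **(B2) «FACES WITH PARAMETERS» ED. 2** (LH3-plan (g3) RULING #15; (I₁) spec-owner LH7-p04 (g4) «= binder» 2026-09-02T10:30:17Z), seat LH3-p02 (g4); sequel of ★ ED. 1
`ArchOrbFamGExtFaceJetBounds` (p851037) and ★ `ArchRankOneCasimirUniformFamily` (§A∕§B).  Count-neutral.

THE MATHEMATICS.  Near a semiregular point `p` of the noncompact wall `(w, i, j)` Harish-Chandra descent (★ (B-desc) box `exists_descent_box_chartOrbG`, LH3-p04; ★ (R4) wall factor,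
LH1-p03) writes the twisted family through the wall chart `A c = (π c, ν c)` (`π c = c − ν c • hcNrm`, `ν c = (c w i − c w j)∕2`; ★ `exists_clm_wallChart`, F0P3a-p08) as
`e^{ρ} · orbFamGExt S′ = M₁(A c) · H₁(A c)` with a COFACTOR `M₁ (q, ψ) = K₁ (ce ψ · Pf q − Ef q)` smooth on `Q ×ˢ univ` and a READER `H₁ (q, ψ) = Φ₁ (g q) ψ` — the rank-one elliptic
orbital integral of the member `g q` of an admissible smooth family (SPEC-I3; the (I₃) assembly ★ FILE 2b `hasOneSidedJump_iteratedFDeriv_adaptedWord_of_twoChart` reads the SAME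
tokens).  The (I₁) content: every jet of `H₁` is bounded near `(p, 0)` off `ψ = 0` — §C: a basis word of `P × ℝ` (basis `(b_P, 0) ⊔ (0, 1)`) is a nested partial, which ★ FILE 1b
`iteratedFDeriv_readers_eq_iteratedDeriv_foldr_local` reads as a NORMAL jet `(Φ₁ (g′ q))⁽ᵃ⁾ ψ` of a transversally differentiated member `g′ = D^β g`; those are bounded on ONE punctured
`ψ`-neighbourhood UNIFORMLY in `q` near `p` (hypothesis `hbd` — ★ §B `RankOneCasimir.exists_forall_eventually_norm_iteratedDeriv_orbitalIntegral_le_of_contDiff_family` = ★ (ELL-∞-UNIF)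
p850750 §4 over ★ (B2a)); finitely many words and ★ (B2b) `exists_forall_norm_iteratedFDeriv_le_of_apply_basis` give the jet bounds.  §0 multiplies by the cofactor (Leibniz with a
LOCALLY smooth factor), ★ ED. 1 §1 pulls back along `A`, ★ ED. 1 §2–§3 turn «near `p` on `InRegG`» into «off the one wall» and divide by `e^{ρ}`.
* §0 `exists_nhds_bddAbove_norm_iteratedFDeriv_mul_of_contDiffOn` — ★ ED. 1's Leibniz packaging with `ContDiffOn ℝ ∞ f Vf` (open `Vf ∋ x`) instead of `ContDiff`.
* §C **`exists_nhds_bddAbove_norm_iteratedFDeriv_reader_of_uniform`** (generic readers `Φ : (Y → W′) → ℝ → F`, `Adm`, `D`, (H1)∕(H2) on `Q ×ˢ T`, `hbd`) :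
  `∀ k, ∃ U ∈ 𝓝 (q₀, 0), BddAbove (‖Dᵏ(z ↦ Φ (g z.1) z.2)‖ '' (U ∩ Q ×ˢ (T ∖ {0})))`.
* §D HEAD **`exists_nhds_bddAbove_norm_iteratedFDeriv_orbFamGExt_of_wallDescent`** — GIVEN-form over ★ FILE 2b's tokens `(Φ₁ T₁ hray Adm D hcl Q h1₁ h2₁ g Pf Ef ce K₁ U₁ hdesc₁)` + `hbd` ⇒
  `∃ U ∈ 𝓝 p, BddAbove (‖Dⁿ(orbFamGExt ν′ a′ S′)‖ '' (U ∩ InRegG (slotSign α) S′))` — the (B1) ★ p850995 `hwall` socket at every face point (F₀) = `HcSemireg`; the assembler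
  instantiates `Φ₁, Adm, D, h1₁, h2₁` once for (I₁) and (I₃) alike (★ (B-par) FILE B) and `hbd` by ★ §B.
HONEST LABEL: (F′) non-generic face points and (B3) compact-scalar corners are NOT covered (LH7-p04 10:30:17Z; RULING #15); HC_CM is proved only modulo the 7 printed citations
(2 remaining: hLiu418 = `stmt-HodgeConjecture-24832`, h413 = `stmt-HodgeConjecture-24833`) until rung 0 closes; this file moves no row of the books.

## References
* [Varadarajan1977] V. S. Varadarajan, *Harmonic Analysis on Real Reductive Groups*, LNM 576 (1977), Part I §1.12 (`'F_f` and its derivatives bounded on `T_{in-reg}`).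
* [Bouaziz1994IntegralesOrbitales] A. Bouaziz, *Intégrales orbitales sur les groupes de Lie réductifs*, Ann. Sci. ÉNS 27 (1994), §3.1 (I₁)–(I₂) p. 579, §3.2 (I₃) p. 580.
* [Shelstad1979] D. Shelstad, *Characters and inner forms of a quasi-split group over ℝ*, Compositio Math. 39 (1979), §4 pp. 22–25 (adapted coordinates at a wall).
* [HormanderALPDO1] L. Hörmander, *The Analysis of Linear Partial Differential Operators I*, 2nd ed. (1990), §1.1 Thm. 1.1.8, (1.1.9).
-/

set_option autoImplicit false

noncomputable section

open Set Filter Topology Function MeasureTheory NumberField NumberField.InfinitePlace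
open scoped ContDiff MatrixGroups Matrix Classical

/-! ## §0 Generic: Leibniz packaging of local jet bounds against a LOCALLY smooth factor -/

namespace Literature.Analysis.Calculus

variable {V : Type*} [NormedAddCommGroup V] [NormedSpace ℝ V] {𝔸 : Type*} [NormedRing 𝔸] [NormedAlgebra ℝ 𝔸]

/-- **Leibniz packaging of LOCAL jet bounds, local factor**: `f` of class `C^∞` on an open neighbourhood `Vf` of `x`, `H` of class `Cⁿ` on an open `O` with every jet of order `≤ n`
bounded on `U ∩ O` for some neighbourhood `U` of `x` ⇒ the `n`-jet of `f · H` is bounded on `U′ ∩ O` for a neighbourhood `U′` of `x` (twin of ★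
`exists_nhds_bddAbove_norm_iteratedFDeriv_mul` with `ContDiffOn` instead of `ContDiff` for `f`; `x ∈ O` is NOT required). [cite: HormanderALPDO1, §1.1 (1.1.9)] -/
theorem exists_nhds_bddAbove_norm_iteratedFDeriv_mul_of_contDiffOn {f H : V → 𝔸} {Vf : Set V} (hVf : IsOpen Vf) {x : V} (hxV : x ∈ Vf) (hf : ContDiffOn ℝ ∞ f Vf)
    {O : Set V} (hO : IsOpen O) {n : ℕ} (hH : ContDiffOn ℝ n H O)
    (hb : ∀ k ≤ n, ∃ U ∈ 𝓝 x, BddAbove ((fun y => ‖iteratedFDeriv ℝ k H y‖) '' (U ∩ O))) :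
    ∃ U ∈ 𝓝 x, BddAbove ((fun y => ‖iteratedFDeriv ℝ n (fun y => f y * H y) y‖) '' (U ∩ O)) := by
  -- eventual bounds for the jets of `H` of order `≤ n`
  have hHev : ∀ k : Fin (n + 1), ∃ B : ℝ, ∀ᶠ y in 𝓝 x, y ∈ O → ‖iteratedFDeriv ℝ (k : ℕ) H y‖ ≤ B := by
    intro k
    obtain ⟨U, hU, B, hB⟩ := hb k (Nat.lt_succ_iff.1 k.2)
    exact ⟨B, Filter.mem_of_superset hU fun y hy hyO => hB ⟨y, ⟨hy, hyO⟩, rfl⟩⟩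
  choose B hB using hHev
  -- eventual bounds for the jets of `f` (continuity on the open `Vf`)
  have hfev : ∀ k : Fin (n + 1), ∀ᶠ y in 𝓝 x, ‖iteratedFDeriv ℝ (k : ℕ) f y‖ ≤ ‖iteratedFDeriv ℝ (k : ℕ) f x‖ + 1 := by
    intro k
    have hcW : ContinuousOn (iteratedFDerivWithin ℝ (k : ℕ) f Vf) Vf := hf.continuousOn_iteratedFDerivWithin (mod_cast le_top) hVf.uniqueDiffOn
    have hc : ContinuousOn (fun y => ‖iteratedFDeriv ℝ (k : ℕ) f y‖) Vf :=
      (hcW.congr fun y hy => ((iteratedFDerivWithin_of_isOpen (k : ℕ) hVf) hy).symm).norm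
    have ht := (hc.continuousAt (hVf.mem_nhds hxV)).eventually (gt_mem_nhds (lt_add_one _))
    exact ht.mono fun y hy => hy.le
  have hall : ∀ᶠ y in 𝓝 x, ∀ k : Fin (n + 1), (y ∈ O → ‖iteratedFDeriv ℝ (k : ℕ) H y‖ ≤ B k) ∧ ‖iteratedFDeriv ℝ (k : ℕ) f y‖ ≤ ‖iteratedFDeriv ℝ (k : ℕ) f x‖ + 1 :=
    eventually_all.2 fun k => (hB k).and (hfev k)
  set B' : ℕ → ℝ := fun m => if h : m < n + 1 then max (B ⟨m, h⟩) 0 else 0 with hB'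
  refine ⟨{y | ∀ k : Fin (n + 1), (y ∈ O → ‖iteratedFDeriv ℝ (k : ℕ) H y‖ ≤ B k) ∧ ‖iteratedFDeriv ℝ (k : ℕ) f y‖ ≤ ‖iteratedFDeriv ℝ (k : ℕ) f x‖ + 1} ∩ Vf,
    inter_mem hall (hVf.mem_nhds hxV), ∑ i ∈ Finset.range (n + 1), (n.choose i : ℝ) * (‖iteratedFDeriv ℝ i f x‖ + 1) * B' (n - i), ?_⟩
  rintro _ ⟨y, ⟨⟨hy, hyV⟩, hyO⟩, rfl⟩
  have hOV : IsOpen (O ∩ Vf) := hO.inter hVf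
  have hfO : ContDiffOn ℝ n f (O ∩ Vf) := (hf.of_le (mod_cast le_top)).mono inter_subset_right
  have hHO : ContDiffOn ℝ n H (O ∩ Vf) := hH.mono inter_subset_left
  show ‖iteratedFDeriv ℝ n (fun y => f y * H y) y‖ ≤ _
  rw [← (iteratedFDerivWithin_of_isOpen n hOV) ⟨hyO, hyV⟩]
  refine (norm_iteratedFDerivWithin_mul_le hfO hHO hOV.uniqueDiffOn ⟨hyO, hyV⟩ le_rfl).trans (Finset.sum_le_sum fun i hi => ?_)
  have hi' : i < n + 1 := Finset.mem_range.1 hi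
  have hni : n - i < n + 1 := by omega
  rw [(iteratedFDerivWithin_of_isOpen i hOV) ⟨hyO, hyV⟩, (iteratedFDerivWithin_of_isOpen (n - i) hOV) ⟨hyO, hyV⟩]
  have h1 : ‖iteratedFDeriv ℝ i f y‖ ≤ ‖iteratedFDeriv ℝ i f x‖ + 1 := (hy ⟨i, hi'⟩).2
  have h2 : ‖iteratedFDeriv ℝ (n - i) H y‖ ≤ B' (n - i) := by
    have h := (hy ⟨n - i, hni⟩).1 hyO
    simp only [hB', dif_pos hni]
    exact h.trans (le_max_left _ _)
  calc (n.choose i : ℝ) * ‖iteratedFDeriv ℝ i f y‖ * ‖iteratedFDeriv ℝ (n - i) H y‖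
      ≤ (n.choose i : ℝ) * (‖iteratedFDeriv ℝ i f x‖ + 1) * B' (n - i) := by gcongr

/-! ## §C Readers: uniform punctured bounds on the normal jets of every admissible family member + nested partials ⇒ LOCAL JET BOUNDS of the reader on the punctured product set -/

section Readers

variable {P : Type*} [NormedAddCommGroup P] [NormedSpace ℝ P] [FiniteDimensional ℝ P] {Y W' F : Type*} [NormedAddCommGroup F] [NormedSpace ℝ F]

/-- **LOCAL JET BOUNDS OF A READER FROM UNIFORM NORMAL-JET BOUNDS OF THE FAMILY** (the (I₁) engine at a face, in the reader currency of ★ `IteratedFDerivParamWords[Local]`).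
Readers `z ↦ Φ (g z.1) z.2` of an admissible class `Adm` (closed under the transversal derivatives `D v`), smooth on `Q ×ˢ T` ((H1)) with (H2) `∂_{(v,0)} Φ(g ·) = Φ(D v g ·)`; IF for
every admissible `g′`, every order `a` and every compact `K ⊆ Q` the normal jets `(Φ (g′ q))⁽ᵃ⁾ ψ` are bounded on ONE punctured neighbourhood of `ψ = 0` UNIFORMLY in `q ∈ K` (`hbd` —
★ `RankOneCasimir.exists_forall_eventually_norm_iteratedDeriv_orbitalIntegral_le_of_contDiff_family` for the rank-one elliptic orbital integral), THEN every jet of the reader of an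
admissible `g` is bounded near `(q₀, 0)` on `Q ×ˢ (T ∖ {0})`: basis words of `P × ℝ` (a basis `(b_P, 0) ⊔ (0, 1)`) are nested partials = normal jets of the members `g′ = D^{β} g`
(★ `iteratedFDeriv_readers_eq_iteratedDeriv_foldr_local`), finitely many words, and ★ (B2b) `exists_forall_norm_iteratedFDeriv_le_of_apply_basis` sums them.
[cite: HormanderALPDO1, §1.1 Thm. 1.1.8, (1.1.9)] [cite: Bouaziz1994IntegralesOrbitales, §3.1 (I₁)–(I₂) p. 579; §3.2 p. 580] [cite: Varadarajan1977, Part I §1.12] -/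
theorem exists_nhds_bddAbove_norm_iteratedFDeriv_reader_of_uniform {Q : Set P} (hQ : IsOpen Q) {T : Set ℝ} (hT : IsOpen T) (Φ : (Y → W') → ℝ → F)
    (Adm : (P → Y → W') → Prop) (D : P → (P → Y → W') → (P → Y → W')) (hcl : ∀ g, Adm g → ∀ v, Adm (D v g))
    (h1 : ∀ g, Adm g → ContDiffOn ℝ ∞ (fun z : P × ℝ => Φ (g z.1) z.2) (Q ×ˢ T))
    (h2 : ∀ g, Adm g → ∀ (v : P) (z : P × ℝ), z ∈ Q ×ˢ T → fderiv ℝ (fun z : P × ℝ => Φ (g z.1) z.2) z (v, 0) = Φ (D v g z.1) z.2)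
    (hbd : ∀ g, Adm g → ∀ (a : ℕ) (K : Set P), IsCompact K → K ⊆ Q → ∃ B : ℝ, ∀ᶠ ψ in 𝓝[≠] (0 : ℝ), ∀ q ∈ K, ‖iteratedDeriv a (Φ (g q)) ψ‖ ≤ B)
    (g : P → Y → W') (hg : Adm g) {q₀ : P} (hq₀ : q₀ ∈ Q) (k : ℕ) :
    ∃ U ∈ 𝓝 ((q₀, (0 : ℝ)) : P × ℝ), BddAbove ((fun z => ‖iteratedFDeriv ℝ k (fun z : P × ℝ => Φ (g z.1) z.2) z‖) '' (U ∩ Q ×ˢ (T ∩ {0}ᶜ))) := by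
  -- a compact ball of parameters inside `Q`
  obtain ⟨r, hr, hrQ⟩ := Metric.nhds_basis_closedBall.mem_iff.1 (hQ.mem_nhds hq₀)
  have hK : IsCompact (Metric.closedBall q₀ r) := isCompact_closedBall q₀ r
  -- the product basis `(b_P, 0) ⊔ (0, 1)` of `P × ℝ`
  set b : Module.Basis (Fin (Module.finrank ℝ P) ⊕ Unit) ℝ (P × ℝ) := (Module.finBasis ℝ P).prod (Module.Basis.singleton Unit ℝ) with hb
  have hb_inl : ∀ i, b (Sum.inl i) = ((Module.finBasis ℝ P) i, (0 : ℝ)) := fun i =>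
    Prod.ext (Module.Basis.prod_apply_inl_fst _ _ i) (Module.Basis.prod_apply_inl_snd _ _ i)
  have hb_inr : ∀ u, b (Sum.inr u) = ((0 : P), (1 : ℝ)) := fun u =>
    Prod.ext (Module.Basis.prod_apply_inr_fst _ _ u) (by rw [Module.Basis.prod_apply_inr_snd, Module.Basis.singleton_apply])
  -- every basis word is read by ★ FILE 1b as a normal jet of an admissible member; uniform bound for it
  have hword : ∀ I : Fin k → Fin (Module.finrank ℝ P) ⊕ Unit, ∃ (a : ℕ) (g' : P → Y → W'), Adm g' ∧
      ∀ z : P × ℝ, z ∈ Q ×ˢ T → iteratedFDeriv ℝ k (fun z : P × ℝ => Φ (g z.1) z.2) z (fun r => b (I r)) = iteratedDeriv a (Φ (g' z.1)) z.2 := by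
    intro I
    have hwn : ∀ r, (Sum.elim (fun _ => false) (fun _ => true) (I r)) = true → b (I r) = ((0 : P), (1 : ℝ)) := by
      intro r hr
      cases hI : I r with
      | inl i => rw [hI] at hr; simp at hr
      | inr u => exact hb_inr u
    have hwt : ∀ r, (Sum.elim (fun _ => false) (fun _ => true) (I r)) = false → (b (I r)).2 = 0 := by
      intro r hr
      cases hI : I r with
      | inl i => rw [hb_inl]
      | inr u => rw [hI] at hr; simp at hr
    obtain ⟨hAdm, hread⟩ := iteratedFDeriv_readers_eq_iteratedDeriv_foldr_local hQ (fun _ : Unit => T) (fun _ => hT) (fun _ : Unit => Φ) Adm D hcl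
      (fun _ g hg => h1 g hg) (fun _ g hg => h2 g hg) (fun r => b (I r)) (fun r => Sum.elim (fun _ => false) (fun _ => true) (I r)) hwn hwt g hg
    exact ⟨_, _, hAdm, fun z hz => hread () z hz⟩
  choose a g' hg' hread using hword
  have hB : ∀ I : Fin k → Fin (Module.finrank ℝ P) ⊕ Unit, ∃ B : ℝ, ∀ᶠ ψ in 𝓝[≠] (0 : ℝ), ∀ q ∈ Metric.closedBall q₀ r, ‖iteratedDeriv (a I) (Φ (g' I q)) ψ‖ ≤ B :=
    fun I => hbd (g' I) (hg' I) (a I) _ hK hrQ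
  choose B hB using hB
  -- one punctured `ψ`-neighbourhood for all the (finitely many) words
  have hall : ∀ᶠ ψ in 𝓝[≠] (0 : ℝ), ∀ I : Fin k → Fin (Module.finrank ℝ P) ⊕ Unit, ∀ q ∈ Metric.closedBall q₀ r, ‖iteratedDeriv (a I) (Φ (g' I q)) ψ‖ ≤ B I :=
    eventually_all.2 hB
  rw [eventually_nhdsWithin_iff, Metric.eventually_nhds_iff] at hall
  obtain ⟨ε, hε, hεall⟩ := hall
  refine ⟨Metric.ball q₀ r ×ˢ Metric.ball (0 : ℝ) ε, prod_mem_nhds (Metric.ball_mem_nhds q₀ hr) (Metric.ball_mem_nhds (0 : ℝ) hε), ?_⟩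
  have hwords : ∀ I : Fin k → Fin (Module.finrank ℝ P) ⊕ Unit, ∃ B' : ℝ, ∀ z ∈ (Metric.ball q₀ r ×ˢ Metric.ball (0 : ℝ) ε) ∩ Q ×ˢ (T ∩ {0}ᶜ),
      ‖iteratedFDeriv ℝ k (fun z : P × ℝ => Φ (g z.1) z.2) z (fun r => b (I r))‖ ≤ B' := by
    intro I
    refine ⟨B I, fun z hz => ?_⟩
    obtain ⟨⟨hz1, hz2⟩, hzQ, hzT, hz0⟩ := hz
    rw [hread I z ⟨hzQ, hzT⟩]
    exact hεall hz2 hz0 I z.1 (Metric.ball_subset_closedBall hz1)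
  obtain ⟨Btot, hBtot⟩ := exists_forall_norm_iteratedFDeriv_le_of_apply_basis b hwords
  exact ⟨Btot, forall_mem_image.2 hBtot⟩

end Readers

end Literature.Analysis.Calculus

/-! ## §D THE FACE `hwall` FROM A WALL-DESCENT READER FAMILY (GIVEN-form over ★ FILE 2b's tokens) -/

namespace Literature.NumberTheory.Rogawski1990

open Literature.NumberTheory.Automorphic Literature.NumberTheory.Automorphic.UnitaryGroup Literature.NumberTheory.Automorphic.ArchCartan
open Literature.Analysis.Calculus

section Face

variable (L : Type) [Field L] [NumberField L] [IsCMField L] (α : Fin 3 → L)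
  [MeasurableSpace ↥(arch (↥(maximalRealSubfield L)) L (IsCMField.complexConj L) 3 (Matrix.diagonal α))]
  [BorelSpace ↥(arch (↥(maximalRealSubfield L)) L (IsCMField.complexConj L) 3 (Matrix.diagonal α))]
  (ν' : Measure ↥(arch (↥(maximalRealSubfield L)) L (IsCMField.complexConj L) 3 (Matrix.diagonal α))) [IsFiniteMeasureOnCompacts ν'] [ν'.IsMulRightInvariant]
  (a' : ↥(arch (↥(maximalRealSubfield L)) L (IsCMField.complexConj L) 3 (Matrix.diagonal α)) → ℂ)
  (S' : Finset {w : InfinitePlace L // IsComplex w})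

/-- **(I₁) AT A FACE FROM THE WALL-DESCENT READER FAMILY** — the `hwall` binder of ★ (B1) `bddAbove_norm_iteratedFDeriv_inter_inRegG_of_forall_wall` at a semiregular point `p` of the
noncompact wall `(w, i, j)`, GIVEN, in the tokens of ★ (B-trans) FILE 2b `hasOneSidedJump_iteratedFDeriv_adaptedWord_of_twoChart` (compact-chart half only): a reader `Φ₁` with
regular set `T₁ ∋ᶠ 0⁺⁻` (`hray`), an admissible class `Adm` closed under the transversal derivatives `D`, the reader clauses (H1)∕(H2) on `Q ×ˢ T₁` (★ (B-par)), an admissible `g`, the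
smooth cofactor data `Pf, Ef` (`C^∞` on `Q`), `ce` (`C^∞`), `K₁`, and the DESCENT IDENTITY `hdesc₁` on an open `U₁ ∋ p` (★ (B-desc) box p851016 + ★ (R4)):
`e^{ρ}_{S′}(c) · orbFamGExt S′ c = K₁ (ce (ν c) Pf (π c) − Ef (π c)) · Φ₁ (g (π c)) (ν c)` for `ν c ∈ T₁` — PLUS the one (I₁)-specific input `hbd`: for every admissible `g′`, order `a`
and compact `K ⊆ Q`, the normal jets `(Φ₁ (g′ q))⁽ᵃ⁾` are bounded on a punctured neighbourhood of `0` uniformly in `q ∈ K` (★ `RankOneCasimir.…_le_of_contDiff_family`).  THEN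
`∃ U ∈ 𝓝 p, BddAbove (‖Dⁿ(orbFamGExt ν′ a′ S′)‖ '' (U ∩ InRegG (slotSign α) S′))`.  Proof: §C (reader jets near `(p, 0)` on `Q ×ˢ (T₁ ∖ 0)`) + §0 (Leibniz with the cofactor, smooth on
`Q ×ˢ univ`) + ★ ED. 1 §1 (pull-back along the wall chart `A c = (π c, ν c)`, ★ `exists_clm_wallChart`) + ★ ED. 1 §3.
[cite: Varadarajan1977, Part I §1.12] [cite: Bouaziz1994IntegralesOrbitales, §3.1 (I₁)–(I₂) p. 579; §3.2 p. 580] [cite: Shelstad1979, §4 pp. 22–25] -/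
theorem exists_nhds_bddAbove_norm_iteratedFDeriv_orbFamGExt_of_wallDescent {w : {w : InfinitePlace L // IsComplex w}} (hw : w ∉ S') {i j : Fin 3} (hij : i ≠ j)
    (hs : slotSign L α w i ≠ slotSign L α w j) {p : {w : InfinitePlace L // IsComplex w} → Fin 3 → ℝ} (hp : HcSemireg S' w i j p)
    {Y W' : Type*} (Φ₁ : (Y → W') → ℝ → ℂ) {T₁ : Set ℝ} (hT₁ : IsOpen T₁) (hray : ∀ᶠ t : ℝ in 𝓝[≠] 0, t ∈ T₁)
    (Adm : (({w : InfinitePlace L // IsComplex w} → Fin 3 → ℝ) → Y → W') → Prop)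
    (D : ({w : InfinitePlace L // IsComplex w} → Fin 3 → ℝ) → (({w : InfinitePlace L // IsComplex w} → Fin 3 → ℝ) → Y → W') → (({w : InfinitePlace L // IsComplex w} → Fin 3 → ℝ) → Y → W'))
    (hcl : ∀ g, Adm g → ∀ v, Adm (D v g)) {Q : Set ({w : InfinitePlace L // IsComplex w} → Fin 3 → ℝ)} (hQ : IsOpen Q) (hpQ : p ∈ Q)
    (h1₁ : ∀ g, Adm g → ContDiffOn ℝ ∞ (fun z : ({w : InfinitePlace L // IsComplex w} → Fin 3 → ℝ) × ℝ => Φ₁ (g z.1) z.2) (Q ×ˢ T₁))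
    (h2₁ : ∀ g, Adm g → ∀ (v : {w : InfinitePlace L // IsComplex w} → Fin 3 → ℝ) (z : ({w : InfinitePlace L // IsComplex w} → Fin 3 → ℝ) × ℝ), z ∈ Q ×ˢ T₁ →
      fderiv ℝ (fun z : ({w : InfinitePlace L // IsComplex w} → Fin 3 → ℝ) × ℝ => Φ₁ (g z.1) z.2) z (v, 0) = Φ₁ (D v g z.1) z.2)
    (g : ({w : InfinitePlace L // IsComplex w} → Fin 3 → ℝ) → Y → W') (hg : Adm g)
    (Pf Ef : ({w : InfinitePlace L // IsComplex w} → Fin 3 → ℝ) → ℂ) (hPf : ContDiffOn ℝ ∞ Pf Q) (hEf : ContDiffOn ℝ ∞ Ef Q)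
    (ce : ℝ → ℂ) (hce : ContDiff ℝ ∞ ce) (K₁ : ℂ)
    {U₁ : Set ({w : InfinitePlace L // IsComplex w} → Fin 3 → ℝ)} (hU₁ : IsOpen U₁) (hpU₁ : p ∈ U₁)
    (hdesc₁ : ∀ c ∈ U₁, (c w i - c w j) / 2 ∈ T₁ →
      archERhoG S' c * orbFamGExt L α ν' a' S' c =
        K₁ * (ce ((c w i - c w j) / 2) * Pf (c - ((c w i - c w j) / 2) • hcNrm w i j) - Ef (c - ((c w i - c w j) / 2) • hcNrm w i j)) *
          Φ₁ (g (c - ((c w i - c w j) / 2) • hcNrm w i j)) ((c w i - c w j) / 2))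
    (hbd : ∀ g', Adm g' → ∀ (a : ℕ) (K : Set ({w : InfinitePlace L // IsComplex w} → Fin 3 → ℝ)), IsCompact K → K ⊆ Q →
      ∃ B : ℝ, ∀ᶠ ψ in 𝓝[≠] (0 : ℝ), ∀ q ∈ K, ‖iteratedDeriv a (Φ₁ (g' q)) ψ‖ ≤ B)
    (n : ℕ) :
    ∃ U ∈ 𝓝 p, BddAbove ((fun c => ‖iteratedFDeriv ℝ n (orbFamGExt L α ν' a' S') c‖) '' (U ∩ InRegG (slotSign L α) S')) := by
  -- the wall chart as a CLM and its value at `p`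
  obtain ⟨A, hA⟩ := exists_clm_wallChart w i j
  have hAp : A p = (p, (0 : ℝ)) := by
    have h := wallChart_add_smul_hcNrm hij hA hp.1 0
    simpa using h
  -- the regular normal parameters near `0`
  have hray' := hray
  rw [eventually_nhdsWithin_iff, Metric.eventually_nhds_iff] at hray'
  obtain ⟨δ, hδ, hδT⟩ := hray'
  -- the model on the product space: cofactor × reader
  set M₁ : ({w : InfinitePlace L // IsComplex w} → Fin 3 → ℝ) × ℝ → ℂ := fun z => K₁ * (ce z.2 * Pf z.1 - Ef z.1) with hM₁def
  set H₁ : ({w : InfinitePlace L // IsComplex w} → Fin 3 → ℝ) × ℝ → ℂ := fun z => Φ₁ (g z.1) z.2 with hH₁def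
  set O : Set (({w : InfinitePlace L // IsComplex w} → Fin 3 → ℝ) × ℝ) := Q ×ˢ (T₁ ∩ {0}ᶜ) with hOdef
  have hOo : IsOpen O := hQ.prod (hT₁.inter isOpen_compl_singleton)
  have hVf : IsOpen (Q ×ˢ (univ : Set ℝ)) := hQ.prod isOpen_univ
  have hpVf : (p, (0 : ℝ)) ∈ Q ×ˢ (univ : Set ℝ) := ⟨hpQ, mem_univ _⟩
  have hM₁ : ContDiffOn ℝ ∞ M₁ (Q ×ˢ (univ : Set ℝ)) := contDiffOn_cofactorReader ce hce K₁ (fun q _ => (Pf q, Ef q)) (hPf.prodMk hEf)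
  have hH₁ : ContDiffOn ℝ ∞ H₁ (Q ×ˢ T₁) := h1₁ g hg
  have hH₁O : ContDiffOn ℝ ∞ H₁ O := hH₁.mono (prod_mono le_rfl inter_subset_left)
  have hMH : ContDiffOn ℝ ∞ (fun z => M₁ z * H₁ z) (Q ×ˢ T₁) := (hM₁.mono (prod_mono le_rfl (subset_univ _))).mul hH₁
  -- §C: the reader's jets near `(p, 0)` on `O`; §0: Leibniz with the cofactor
  have hC : ∀ k, ∃ U ∈ 𝓝 ((p, (0 : ℝ)) : ({w : InfinitePlace L // IsComplex w} → Fin 3 → ℝ) × ℝ),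
      BddAbove ((fun z => ‖iteratedFDeriv ℝ k H₁ z‖) '' (U ∩ O)) := fun k =>
    exists_nhds_bddAbove_norm_iteratedFDeriv_reader_of_uniform hQ hT₁ Φ₁ Adm D hcl h1₁ h2₁ hbd g hg hpQ k
  have hL : ∀ k, ∃ U ∈ 𝓝 ((p, (0 : ℝ)) : ({w : InfinitePlace L // IsComplex w} → Fin 3 → ℝ) × ℝ),
      BddAbove ((fun z => ‖iteratedFDeriv ℝ k (fun z => M₁ z * H₁ z) z‖) '' (U ∩ O)) := fun k =>
    exists_nhds_bddAbove_norm_iteratedFDeriv_mul_of_contDiffOn hVf hpVf hM₁ hOo (hH₁O.of_le (mod_cast le_top)) fun k' _ => hC k'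
  -- the ambient neighbourhood: inside `U₁`, wall projection in `Q`, normal parameter `< δ`
  set U : Set ({w : InfinitePlace L // IsComplex w} → Fin 3 → ℝ) := U₁ ∩ A ⁻¹' (Q ×ˢ Metric.ball (0 : ℝ) δ) with hUdef
  have hUo : IsOpen U := hU₁.inter ((hQ.prod Metric.isOpen_ball).preimage A.continuous)
  have hpU : p ∈ U := ⟨hpU₁, by rw [mem_preimage, hAp]; exact ⟨hpQ, Metric.mem_ball_self hδ⟩⟩
  have hν_ne : ∀ c : {w : InfinitePlace L // IsComplex w} → Fin 3 → ℝ, Circle.exp (c w i) ≠ Circle.exp (c w j) → (c w i - c w j) / 2 ≠ 0 := by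
    intro c hc h0
    exact hc (by rw [show c w i = c w j by linarith])
  have hAO : ∀ c ∈ U, Circle.exp (c w i) ≠ Circle.exp (c w j) → A c ∈ Q ×ˢ T₁ ∧ A c ∈ O := by
    intro c hc hcw
    have hc2 : A c ∈ Q ×ˢ Metric.ball (0 : ℝ) δ := hc.2
    rw [hA] at hc2 ⊢
    have hT : (c w i - c w j) / 2 ∈ T₁ := hδT hc2.2 (hν_ne c hcw)
    exact ⟨⟨hc2.1, hT⟩, ⟨hc2.1, hT, hν_ne c hcw⟩⟩
  -- ED. 1 §3 (all orders) for the ambient model `(M₁ · H₁) ∘ A`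
  refine forall_exists_nhds_bddAbove_norm_iteratedFDeriv_orbFamGExt_of_faceModel L α ν' a' S' hw hij hs hp (hUo.mem_nhds hpU)
    ((fun z => M₁ z * H₁ z) ∘ A) (fun c hc hcw => ?_) (hMH.comp A.contDiff.contDiffOn fun c hc => (hAO c hc.1 hc.2).1) (fun k => ?_) n
  · -- the descent identity, read through the chart
    have hT : (c w i - c w j) / 2 ∈ T₁ := ((hAO c hc hcw).1).2 |> fun h => by rw [hA] at h; exact h
    rw [hdesc₁ c hc.1 hT, comp_apply, hA]
  · -- jets of order `k` near `p`, pulled back along `A`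
    obtain ⟨U'', hU'', hB⟩ := hL k
    have hpre : A ⁻¹' interior U'' ∈ 𝓝 p := A.continuous.continuousAt.preimage_mem_nhds (by rw [hAp]; exact interior_mem_nhds.2 hU'')
    refine ⟨U ∩ A ⁻¹' interior U'', inter_mem (hUo.mem_nhds hpU) hpre, ?_⟩
    have hO'o : IsOpen (interior U'' ∩ O) := isOpen_interior.inter hOo
    have hmaps : MapsTo A ((U ∩ A ⁻¹' interior U'') ∩ {c | Circle.exp (c w i) ≠ Circle.exp (c w j)}) (interior U'' ∩ O) :=
      fun c hc => ⟨hc.1.2, (hAO c hc.1.1 hc.2).2⟩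
    have hsub : interior U'' ∩ O ⊆ Q ×ˢ T₁ := fun z hz => ⟨hz.2.1, hz.2.2.1⟩
    refine bddAbove_norm_iteratedFDeriv_comp_clm_image A hO'o ((hMH.of_le (mod_cast le_top)).mono hsub) hmaps ?_
    have hsub' : interior U'' ∩ O ⊆ U'' ∩ O := fun z hz => ⟨interior_subset hz.1, hz.2⟩
    exact hB.mono (image_mono ((mapsTo_iff_image_subset.1 hmaps).trans hsub'))

end Face

/-! ## ED. 2 (append-only) — the ONE-WALL base point (stratum (F) ⊇ (F₀)): the same head for (B-desc′) `exists_descent_box_orbFamGExt_inRegG` at non-generic face points -/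

section FaceOneWall

variable (L : Type) [Field L] [NumberField L] [IsCMField L] (α : Fin 3 → L)
  [MeasurableSpace ↥(arch (↥(maximalRealSubfield L)) L (IsCMField.complexConj L) 3 (Matrix.diagonal α))]
  [BorelSpace ↥(arch (↥(maximalRealSubfield L)) L (IsCMField.complexConj L) 3 (Matrix.diagonal α))]
  (ν' : Measure ↥(arch (↥(maximalRealSubfield L)) L (IsCMField.complexConj L) 3 (Matrix.diagonal α))) [IsFiniteMeasureOnCompacts ν'] [ν'.IsMulRightInvariant]
  (a' : ↥(arch (↥(maximalRealSubfield L)) L (IsCMField.complexConj L) 3 (Matrix.diagonal α)) → ℂ)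
  (S' : Finset {w : InfinitePlace L // IsComplex w})

/-- **(I₁) AT A ONE-WALL POINT FROM THE WALL-DESCENT READER FAMILY** — ★ `exists_nhds_bddAbove_norm_iteratedFDeriv_orbFamGExt_of_wallDescent` with the base point `x` of the (F) stratum
(`hx : x w i = x w j`, `hxk`, `hxin` — LH7-p04's (B-desc′) base-point text at `(i, j) = (0, 2)`) instead of `HcSemireg`; all other tokens unchanged (so (B-desc′)'s identity on
`U₁ ∩ {ν c ∈ T₁}` at a non-generic face point plugs in as `hdesc₁`). [cite: Varadarajan1977, Part I §1.12] [cite: Bouaziz1994IntegralesOrbitales, §3.1 (I₁)–(I₂) p. 579; §3.2 p. 580]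
[cite: Shelstad1979, §4 pp. 22–25] -/
theorem exists_nhds_bddAbove_norm_iteratedFDeriv_orbFamGExt_of_wallDescent_oneWall {w : {w : InfinitePlace L // IsComplex w}} (hw : w ∉ S') {i j : Fin 3} (hij : i ≠ j)
    (hs : slotSign L α w i ≠ slotSign L α w j) {p : {w : InfinitePlace L // IsComplex w} → Fin 3 → ℝ} (hx : p w i = p w j)
    (hxk : Circle.exp (p w (hcThird i j)) ≠ Circle.exp (p w i))
    (hxin : ∀ w', w' ∉ S' → w' ≠ w → ∀ i' j' : Fin 3, i' ≠ j' → slotSign L α w' i' ≠ slotSign L α w' j' → Circle.exp (p w' i') ≠ Circle.exp (p w' j'))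
    {Y W' : Type*} (Φ₁ : (Y → W') → ℝ → ℂ) {T₁ : Set ℝ} (hT₁ : IsOpen T₁) (hray : ∀ᶠ t : ℝ in 𝓝[≠] 0, t ∈ T₁)
    (Adm : (({w : InfinitePlace L // IsComplex w} → Fin 3 → ℝ) → Y → W') → Prop)
    (D : ({w : InfinitePlace L // IsComplex w} → Fin 3 → ℝ) → (({w : InfinitePlace L // IsComplex w} → Fin 3 → ℝ) → Y → W') → (({w : InfinitePlace L // IsComplex w} → Fin 3 → ℝ) → Y → W'))
    (hcl : ∀ g, Adm g → ∀ v, Adm (D v g)) {Q : Set ({w : InfinitePlace L // IsComplex w} → Fin 3 → ℝ)} (hQ : IsOpen Q) (hpQ : p ∈ Q)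
    (h1₁ : ∀ g, Adm g → ContDiffOn ℝ ∞ (fun z : ({w : InfinitePlace L // IsComplex w} → Fin 3 → ℝ) × ℝ => Φ₁ (g z.1) z.2) (Q ×ˢ T₁))
    (h2₁ : ∀ g, Adm g → ∀ (v : {w : InfinitePlace L // IsComplex w} → Fin 3 → ℝ) (z : ({w : InfinitePlace L // IsComplex w} → Fin 3 → ℝ) × ℝ), z ∈ Q ×ˢ T₁ →
      fderiv ℝ (fun z : ({w : InfinitePlace L // IsComplex w} → Fin 3 → ℝ) × ℝ => Φ₁ (g z.1) z.2) z (v, 0) = Φ₁ (D v g z.1) z.2)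
    (g : ({w : InfinitePlace L // IsComplex w} → Fin 3 → ℝ) → Y → W') (hg : Adm g)
    (Pf Ef : ({w : InfinitePlace L // IsComplex w} → Fin 3 → ℝ) → ℂ) (hPf : ContDiffOn ℝ ∞ Pf Q) (hEf : ContDiffOn ℝ ∞ Ef Q)
    (ce : ℝ → ℂ) (hce : ContDiff ℝ ∞ ce) (K₁ : ℂ)
    {U₁ : Set ({w : InfinitePlace L // IsComplex w} → Fin 3 → ℝ)} (hU₁ : IsOpen U₁) (hpU₁ : p ∈ U₁)
    (hdesc₁ : ∀ c ∈ U₁, (c w i - c w j) / 2 ∈ T₁ →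
      archERhoG S' c * orbFamGExt L α ν' a' S' c =
        K₁ * (ce ((c w i - c w j) / 2) * Pf (c - ((c w i - c w j) / 2) • hcNrm w i j) - Ef (c - ((c w i - c w j) / 2) • hcNrm w i j)) *
          Φ₁ (g (c - ((c w i - c w j) / 2) • hcNrm w i j)) ((c w i - c w j) / 2))
    (hbd : ∀ g', Adm g' → ∀ (a : ℕ) (K : Set ({w : InfinitePlace L // IsComplex w} → Fin 3 → ℝ)), IsCompact K → K ⊆ Q →
      ∃ B : ℝ, ∀ᶠ ψ in 𝓝[≠] (0 : ℝ), ∀ q ∈ K, ‖iteratedDeriv a (Φ₁ (g' q)) ψ‖ ≤ B)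
    (n : ℕ) :
    ∃ U ∈ 𝓝 p, BddAbove ((fun c => ‖iteratedFDeriv ℝ n (orbFamGExt L α ν' a' S') c‖) '' (U ∩ InRegG (slotSign L α) S')) := by
  obtain ⟨A, hA⟩ := exists_clm_wallChart w i j
  have hAp : A p = (p, (0 : ℝ)) := by
    have h := wallChart_add_smul_hcNrm hij hA hx 0
    simpa using h
  have hray' := hray
  rw [eventually_nhdsWithin_iff, Metric.eventually_nhds_iff] at hray'
  obtain ⟨δ, hδ, hδT⟩ := hray'
  set M₁ : ({w : InfinitePlace L // IsComplex w} → Fin 3 → ℝ) × ℝ → ℂ := fun z => K₁ * (ce z.2 * Pf z.1 - Ef z.1) with hM₁def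
  set H₁ : ({w : InfinitePlace L // IsComplex w} → Fin 3 → ℝ) × ℝ → ℂ := fun z => Φ₁ (g z.1) z.2 with hH₁def
  set O : Set (({w : InfinitePlace L // IsComplex w} → Fin 3 → ℝ) × ℝ) := Q ×ˢ (T₁ ∩ {0}ᶜ) with hOdef
  have hOo : IsOpen O := hQ.prod (hT₁.inter isOpen_compl_singleton)
  have hVf : IsOpen (Q ×ˢ (univ : Set ℝ)) := hQ.prod isOpen_univ
  have hpVf : (p, (0 : ℝ)) ∈ Q ×ˢ (univ : Set ℝ) := ⟨hpQ, mem_univ _⟩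
  have hM₁ : ContDiffOn ℝ ∞ M₁ (Q ×ˢ (univ : Set ℝ)) := contDiffOn_cofactorReader ce hce K₁ (fun q _ => (Pf q, Ef q)) (hPf.prodMk hEf)
  have hH₁ : ContDiffOn ℝ ∞ H₁ (Q ×ˢ T₁) := h1₁ g hg
  have hH₁O : ContDiffOn ℝ ∞ H₁ O := hH₁.mono (prod_mono le_rfl inter_subset_left)
  have hMH : ContDiffOn ℝ ∞ (fun z => M₁ z * H₁ z) (Q ×ˢ T₁) := (hM₁.mono (prod_mono le_rfl (subset_univ _))).mul hH₁
  have hC : ∀ k, ∃ U ∈ 𝓝 ((p, (0 : ℝ)) : ({w : InfinitePlace L // IsComplex w} → Fin 3 → ℝ) × ℝ),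
      BddAbove ((fun z => ‖iteratedFDeriv ℝ k H₁ z‖) '' (U ∩ O)) := fun k =>
    exists_nhds_bddAbove_norm_iteratedFDeriv_reader_of_uniform hQ hT₁ Φ₁ Adm D hcl h1₁ h2₁ hbd g hg hpQ k
  have hL : ∀ k, ∃ U ∈ 𝓝 ((p, (0 : ℝ)) : ({w : InfinitePlace L // IsComplex w} → Fin 3 → ℝ) × ℝ),
      BddAbove ((fun z => ‖iteratedFDeriv ℝ k (fun z => M₁ z * H₁ z) z‖) '' (U ∩ O)) := fun k =>
    exists_nhds_bddAbove_norm_iteratedFDeriv_mul_of_contDiffOn hVf hpVf hM₁ hOo (hH₁O.of_le (mod_cast le_top)) fun k' _ => hC k'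
  set U : Set ({w : InfinitePlace L // IsComplex w} → Fin 3 → ℝ) := U₁ ∩ A ⁻¹' (Q ×ˢ Metric.ball (0 : ℝ) δ) with hUdef
  have hUo : IsOpen U := hU₁.inter ((hQ.prod Metric.isOpen_ball).preimage A.continuous)
  have hpU : p ∈ U := ⟨hpU₁, by rw [mem_preimage, hAp]; exact ⟨hpQ, Metric.mem_ball_self hδ⟩⟩
  have hν_ne : ∀ c : {w : InfinitePlace L // IsComplex w} → Fin 3 → ℝ, Circle.exp (c w i) ≠ Circle.exp (c w j) → (c w i - c w j) / 2 ≠ 0 := by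
    intro c hc h0
    exact hc (by rw [show c w i = c w j by linarith])
  have hAO : ∀ c ∈ U, Circle.exp (c w i) ≠ Circle.exp (c w j) → A c ∈ Q ×ˢ T₁ ∧ A c ∈ O := by
    intro c hc hcw
    have hc2 : A c ∈ Q ×ˢ Metric.ball (0 : ℝ) δ := hc.2
    rw [hA] at hc2 ⊢
    have hT : (c w i - c w j) / 2 ∈ T₁ := hδT hc2.2 (hν_ne c hcw)
    exact ⟨⟨hc2.1, hT⟩, ⟨hc2.1, hT, hν_ne c hcw⟩⟩
  refine forall_exists_nhds_bddAbove_norm_iteratedFDeriv_orbFamGExt_of_faceModel_oneWall L α ν' a' S' hw hij hs hx hxk hxin (hUo.mem_nhds hpU)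
    ((fun z => M₁ z * H₁ z) ∘ A) (fun c hc hcw => ?_) (hMH.comp A.contDiff.contDiffOn fun c hc => (hAO c hc.1 hc.2).1) (fun k => ?_) n
  · have hT : (c w i - c w j) / 2 ∈ T₁ := ((hAO c hc hcw).1).2 |> fun h => by rw [hA] at h; exact h
    rw [hdesc₁ c hc.1 hT, comp_apply, hA]
  · obtain ⟨U'', hU'', hB⟩ := hL k
    have hpre : A ⁻¹' interior U'' ∈ 𝓝 p := A.continuous.continuousAt.preimage_mem_nhds (by rw [hAp]; exact interior_mem_nhds.2 hU'')
    refine ⟨U ∩ A ⁻¹' interior U'', inter_mem (hUo.mem_nhds hpU) hpre, ?_⟩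
    have hO'o : IsOpen (interior U'' ∩ O) := isOpen_interior.inter hOo
    have hmaps : MapsTo A ((U ∩ A ⁻¹' interior U'') ∩ {c | Circle.exp (c w i) ≠ Circle.exp (c w j)}) (interior U'' ∩ O) :=
      fun c hc => ⟨hc.1.2, (hAO c hc.1.1 hc.2).2⟩
    have hsub : interior U'' ∩ O ⊆ Q ×ˢ T₁ := fun z hz => ⟨hz.2.1, hz.2.2.1⟩
    refine bddAbove_norm_iteratedFDeriv_comp_clm_image A hO'o ((hMH.of_le (mod_cast le_top)).mono hsub) hmaps ?_
    have hsub' : interior U'' ∩ O ⊆ U'' ∩ O := fun z hz => ⟨interior_subset hz.1, hz.2⟩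
    exact hB.mono (image_mono ((mapsTo_iff_image_subset.1 hmaps).trans hsub'))

/-- The `HcSemireg` head is the (F₀) instance of the one-wall head (★ `HcSemireg.oneWall`). [cite: Shelstad1979, §4 p. 22] -/
theorem exists_nhds_bddAbove_norm_iteratedFDeriv_orbFamGExt_of_wallDescent' {w : {w : InfinitePlace L // IsComplex w}} (hw : w ∉ S') {i j : Fin 3} (hij : i ≠ j)
    (hs : slotSign L α w i ≠ slotSign L α w j) {p : {w : InfinitePlace L // IsComplex w} → Fin 3 → ℝ} (hp : HcSemireg S' w i j p)
    {Y W' : Type*} (Φ₁ : (Y → W') → ℝ → ℂ) {T₁ : Set ℝ} (hT₁ : IsOpen T₁) (hray : ∀ᶠ t : ℝ in 𝓝[≠] 0, t ∈ T₁)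
    (Adm : (({w : InfinitePlace L // IsComplex w} → Fin 3 → ℝ) → Y → W') → Prop)
    (D : ({w : InfinitePlace L // IsComplex w} → Fin 3 → ℝ) → (({w : InfinitePlace L // IsComplex w} → Fin 3 → ℝ) → Y → W') → (({w : InfinitePlace L // IsComplex w} → Fin 3 → ℝ) → Y → W'))
    (hcl : ∀ g, Adm g → ∀ v, Adm (D v g)) {Q : Set ({w : InfinitePlace L // IsComplex w} → Fin 3 → ℝ)} (hQ : IsOpen Q) (hpQ : p ∈ Q)
    (h1₁ : ∀ g, Adm g → ContDiffOn ℝ ∞ (fun z : ({w : InfinitePlace L // IsComplex w} → Fin 3 → ℝ) × ℝ => Φ₁ (g z.1) z.2) (Q ×ˢ T₁))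
    (h2₁ : ∀ g, Adm g → ∀ (v : {w : InfinitePlace L // IsComplex w} → Fin 3 → ℝ) (z : ({w : InfinitePlace L // IsComplex w} → Fin 3 → ℝ) × ℝ), z ∈ Q ×ˢ T₁ →
      fderiv ℝ (fun z : ({w : InfinitePlace L // IsComplex w} → Fin 3 → ℝ) × ℝ => Φ₁ (g z.1) z.2) z (v, 0) = Φ₁ (D v g z.1) z.2)
    (g : ({w : InfinitePlace L // IsComplex w} → Fin 3 → ℝ) → Y → W') (hg : Adm g)
    (Pf Ef : ({w : InfinitePlace L // IsComplex w} → Fin 3 → ℝ) → ℂ) (hPf : ContDiffOn ℝ ∞ Pf Q) (hEf : ContDiffOn ℝ ∞ Ef Q)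
    (ce : ℝ → ℂ) (hce : ContDiff ℝ ∞ ce) (K₁ : ℂ)
    {U₁ : Set ({w : InfinitePlace L // IsComplex w} → Fin 3 → ℝ)} (hU₁ : IsOpen U₁) (hpU₁ : p ∈ U₁)
    (hdesc₁ : ∀ c ∈ U₁, (c w i - c w j) / 2 ∈ T₁ →
      archERhoG S' c * orbFamGExt L α ν' a' S' c =
        K₁ * (ce ((c w i - c w j) / 2) * Pf (c - ((c w i - c w j) / 2) • hcNrm w i j) - Ef (c - ((c w i - c w j) / 2) • hcNrm w i j)) *
          Φ₁ (g (c - ((c w i - c w j) / 2) • hcNrm w i j)) ((c w i - c w j) / 2))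
    (hbd : ∀ g', Adm g' → ∀ (a : ℕ) (K : Set ({w : InfinitePlace L // IsComplex w} → Fin 3 → ℝ)), IsCompact K → K ⊆ Q →
      ∃ B : ℝ, ∀ᶠ ψ in 𝓝[≠] (0 : ℝ), ∀ q ∈ K, ‖iteratedDeriv a (Φ₁ (g' q)) ψ‖ ≤ B)
    (n : ℕ) :
    ∃ U ∈ 𝓝 p, BddAbove ((fun c => ‖iteratedFDeriv ℝ n (orbFamGExt L α ν' a' S') c‖) '' (U ∩ InRegG (slotSign L α) S')) :=
  exists_nhds_bddAbove_norm_iteratedFDeriv_orbFamGExt_of_wallDescent_oneWall L α ν' a' S' hw hij hs (HcSemireg.oneWall hp (slotSign L α)).1 (HcSemireg.oneWall hp (slotSign L α)).2.1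
    (HcSemireg.oneWall hp (slotSign L α)).2.2 Φ₁ hT₁ hray Adm D hcl hQ hpQ h1₁ h2₁ g hg Pf Ef hPf hEf ce hce K₁ hU₁ hpU₁ hdesc₁ hbd n

end FaceOneWall

end Literature.NumberTheory.Rogawski1990

end
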